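/-
COR-CM (cell pub-hodgecm2, stage 2 of the Hodge ladder) — count-neutral kernel census (seat prover-pub-hodgecm2-b23-g37-0, binder
prover b23, gen 37; claim EVEN-SLICE F4 (named in the claim, HOME/INBOX.md 2026-08-22T13:48Z); sequel of
`Census/EvenSliceFacesGenerate.lean`).  Theorems + three `Equiv`s (bookkeeping bijections used for counting), on top of seat b17's
orbit-count file `Census/OddDegreeParityLawRelative.lean` (its `fixedByEquiv` / `card_fixedBy_zero` / `descendLE` / Burnside template,
consumed BY NAME; nothing of b17's is restated or re-filed); no `decide` table beyond closed numerals, no certificate, no named fact, no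
geometry, no `sorry`.  `Interfaces.lean` (C1), every E term, B01 and `Transposition/*` are untouched.  HC_CM is NOT proved anywhere in
this cell; nothing here is a headline and nothing here produces a period.
-/
import Summits.HodgeConjecture.CorCM.Census.EvenSliceFacesGenerate

/-!
# The orbit count of the faithful full slice of `(ℤ/2 × A, (1,0))` for `A` of ANY order: Burnside with the anti-periodic types

Seat b17's `card_orbitsA_mul` (`Census/OddDegreeParityLawRelative.lean`) counts the `G`-orbits of nonconstant types
(`G = ℤ/2 × A` acting on the maps `A → ℤ/2` by translation and complementation) — the isogeny classes of simple CM abelian varieties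
other than `E` split by a Galois CM field with group `ℤ/2 × A` — for `|A|` ODD: `#OrbitsA · 2|A| = Σ_y (2^{|A/ℤy|} − 2)`, because
`(1, y)` has no fixed point.  For `|A|` EVEN the elements `(1, y)` with `y` of EVEN order do have fixed points, the ANTI-PERIODIC types
`φ(s − y) + 1 = φ(s)`, exactly `2^{|A/ℤy|}` of them (a torsor under the `y`-periodic maps; one exists by part F2's
`exists_antiperiodic` applied in `A / ℤ(2y)`), and none when the order of `y` is odd (`even_addOrderOf_of_antiperiodic`).  Hence, for
EVERY finite abelian group `A` (**`card_orbitsA_mul_eq`**):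

  `#OrbitsA A · 2|A| = Σ_{y ∈ A} (2^{|A/ℤy|} − 2) + Σ_{y ∈ A, ord y even} 2^{|A/ℤy|}`,

for cyclic `A = ℤ/n` (**`card_orbitsA_zmod_mul_eq`**): `#OrbitsA · 2n = Σ_{a<n} ((2^{gcd(n,a)} − 2) + [n/gcd(n,a) even]·2^{gcd(n,a)})`,
and the instances `#OrbitsA = 3, 7, 19, 55, 179` for `ℤ/4, ℤ/6, ℤ/8, ℤ/10, ℤ/12`, `4` for `(ℤ/2)²`, `29` for `(ℤ/2)³` — so that part
F2's bound «`#OrbitsA A − 1` canonical squares generate» reads `2, 6, 18, 54, 178, 3, 28` rank-four faces for these groups (the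
census minima `2` for `ℤ/4 × ℤ/2 (c ∉ 2G)`, `6` for `ℤ/6 × ℤ/2`, `3` for `(ℤ/2)³`, and lit-andre-3's `178` for `ℤ/2 × ℤ/12 (c ∉ 2G)`).
All [folklore].

## References
* [Pohlmann1968] H. Pohlmann, Algebraic cycles on abelian varieties of complex multiplication type, Ann. of Math. 88 (1968), Thm 1.
* [Milne1999] J. S. Milne, Lefschetz motives and the Tate conjecture, Compositio Math. 117 (1999), Prop. 2.1, p. 54.
-/

namespace Summit.HodgeConjecture.CorCM.Census.EvenSliceOrbitCount

open Finset
open Summit.HodgeConjecture.CorCM.Census.OddDegreeParityLaw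
open Summit.HodgeConjecture.CorCM.Census.OddSliceFacesModel (Ty tw)
open Summit.HodgeConjecture.CorCM.Census.EvenSliceFacesGenerate (exists_antiperiodic)

variable (A : Type) [AddCommGroup A]

/-! ## §1 Anti-periodic types along `y₀`: parity of the order, existence -/

variable {A} in
/-- Iterating the anti-periodicity: `φ (y − k·y₀) + k = φ y`. [folklore] -/
theorem antiperiodic_iter {y₀ : A} {φ : A → ZMod 2} (h : ∀ y, φ (y - y₀) + 1 = φ y) (k : ℕ) (y : A) :
    φ (y - k • y₀) + k = φ y := by
  induction k generalizing y with
  | zero => simp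
  | succ k ih =>
    have e : y - (k + 1) • y₀ = (y - y₀) - k • y₀ := by rw [succ_nsmul]; abel
    rw [e, Nat.cast_succ, ← add_assoc, ih (y - y₀), h y]

variable {A} in
/-- **An anti-periodic type along `y₀` forces the order of `y₀` to be even** (`φ y + ord y₀ = φ y` in `ℤ/2`). [folklore] -/
theorem even_addOrderOf_of_antiperiodic {y₀ : A} {φ : A → ZMod 2} (h : ∀ y, φ (y - y₀) + 1 = φ y) : Even (addOrderOf y₀) := by
  have key := antiperiodic_iter h (addOrderOf y₀) 0
  rw [addOrderOf_nsmul_eq_zero, sub_zero, add_eq_left] at key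
  exact ZMod.natCast_eq_zero_iff_even.mp key

variable {A} in
/-- An anti-periodic type is nonconstant. [folklore] -/
theorem nonconst_of_antiperiodic {y₀ : A} {φ : A → ZMod 2} (h : ∀ y, φ (y - y₀) + 1 = φ y) : ¬ ∀ y, φ y = φ 0 := by
  intro hc
  have h0 := h 0
  rw [hc (0 - y₀), add_eq_left] at h0
  exact absurd h0 (by decide)

variable {A} in
/-- **An anti-periodic type along `y₀` EXISTS when the order of `y₀` is even** (`A` finite): part F2's ordering construction in the
quotient `A / ℤ(2y₀)`, where `y₀` becomes a non-zero element killed by `2`. [folklore] -/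
theorem exists_antiperiodic_of_even [Finite A] {y₀ : A} (hev : Even (addOrderOf y₀)) :
    ∃ φ : A → ZMod 2, ∀ y, φ (y - y₀) + 1 = φ y := by
  classical
  set H : AddSubgroup A := AddSubgroup.zmultiples ((2 : ℕ) • y₀) with hH
  letI : Fintype (A ⧸ H) := Fintype.ofFinite _
  have hpos : 0 < addOrderOf y₀ := addOrderOf_pos y₀
  -- `y₀ ∉ H`: otherwise `(2k − 1) • y₀ = 0` with `ord y₀` even
  have ht0 : ((y₀ : A) : A ⧸ H) ≠ 0 := by
    intro h0
    rw [QuotientAddGroup.eq_zero_iff, hH] at h0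
    obtain ⟨k, hk⟩ := AddSubgroup.mem_zmultiples_iff.mp h0
    have hk' : k • ((2 : ℤ) • y₀) = y₀ := by
      have := hk
      rwa [← natCast_zsmul, Nat.cast_ofNat] at this
    have hz : (2 * k - 1) • y₀ = 0 := by
      have e : (2 * k - 1) • y₀ = k • ((2 : ℤ) • y₀) - y₀ := by module
      rw [e, hk', sub_self]
    have hdvd : (addOrderOf y₀ : ℤ) ∣ 2 * k - 1 := addOrderOf_dvd_iff_zsmul_eq_zero.mpr hz
    obtain ⟨m, hm⟩ := hev
    have h2 : (2 : ℤ) ∣ 2 * k - 1 := by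
      refine dvd_trans ⟨(m : ℤ), ?_⟩ hdvd
      rw [hm]; push_cast; ring
    omega
  have htt : ((y₀ : A) : A ⧸ H) + ((y₀ : A) : A ⧸ H) = 0 := by
    rw [← QuotientAddGroup.mk_add, QuotientAddGroup.eq_zero_iff, hH, ← two_nsmul]
    exact AddSubgroup.mem_zmultiples _
  obtain ⟨ψ, hψ⟩ := exists_antiperiodic (A ⧸ H) ht0 htt
  refine ⟨fun y => ψ (y : A ⧸ H), fun y => ?_⟩
  have key := congrFun hψ ((y : A ⧸ H) - (y₀ : A ⧸ H))
  simp only [tw, sub_add_cancel, add_zero, Pi.add_apply, Pi.one_apply] at key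
  show ψ ((y - y₀ : A) : A ⧸ H) + 1 = ψ (y : A ⧸ H)
  rw [QuotientAddGroup.mk_sub, ← key]

/-! ## §2 Counting the anti-periodic types: a torsor under the periodic ones -/

variable {A} in
/-- The `y₀`-periodic maps `A → ℤ/2` are the maps on `A / ℤy₀` (all maps, constants included). [folklore] -/
noncomputable def periodicEquiv (y₀ : A) :
    {φ : A → ZMod 2 // ∀ y, φ (y - y₀) = φ y} ≃ (A ⧸ AddSubgroup.zmultiples y₀ → ZMod 2) where
  toFun φ := descendLE (AddSubgroup.zmultiples y₀) φ.1 (by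
    rw [AddSubgroup.zmultiples_le, ← sub_periodic_iff]; exact φ.2)
  invFun ψ := ⟨fun y => ψ (y : A ⧸ AddSubgroup.zmultiples y₀), fun y => by
    show ψ ((y - y₀ : A) : A ⧸ AddSubgroup.zmultiples y₀) = ψ (y : A ⧸ AddSubgroup.zmultiples y₀)
    have hq : ((y - y₀ : A) : A ⧸ AddSubgroup.zmultiples y₀) = (y : A ⧸ AddSubgroup.zmultiples y₀) := by
      rw [QuotientAddGroup.mk_sub, sub_eq_self, QuotientAddGroup.eq_zero_iff]
      exact AddSubgroup.mem_zmultiples y₀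
    rw [hq]⟩
  left_inv φ := by
    apply Subtype.ext
    funext y
    rfl
  right_inv ψ := by
    funext q
    induction q using QuotientAddGroup.induction_on with
    | H z => rfl

variable {A} in
/-- **The anti-periodic maps are a torsor under the periodic maps**: subtracting a fixed anti-periodic `φ₁` is a bijection onto the
`y₀`-periodic maps. [folklore] -/
def antiperiodicEquiv {y₀ : A} (φ₁ : A → ZMod 2) (h₁ : ∀ y, φ₁ (y - y₀) + 1 = φ₁ y) :
    {φ : A → ZMod 2 // ∀ y, φ (y - y₀) + 1 = φ y} ≃ {φ : A → ZMod 2 // ∀ y, φ (y - y₀) = φ y} where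
  toFun φ := ⟨φ.1 - φ₁, fun y => by
    have e1 := φ.2 y
    have e2 := h₁ y
    simp only [Pi.sub_apply]
    rw [← e1, ← e2]; ring⟩
  invFun ψ := ⟨ψ.1 + φ₁, fun y => by
    have e1 := ψ.2 y
    have e2 := h₁ y
    simp only [Pi.add_apply]
    rw [e1, ← e2]; ring⟩
  left_inv φ := by apply Subtype.ext; simp
  right_inv ψ := by apply Subtype.ext; simp

variable {A} in
/-- The fixed points of `(1, y₀)` on the nonconstant types are the anti-periodic types along `y₀`. [folklore] -/
def fixedByOneEquiv (y₀ : A) :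
    AddAction.fixedBy (Nonconst A) (((1 : ZMod 2), y₀) : ZMod 2 × A) ≃ {φ : A → ZMod 2 // ∀ y, φ (y - y₀) + 1 = φ y} where
  toFun φ := ⟨φ.1.1, fun y => by
    have := congrArg (fun ψ : Nonconst A => ψ.1 y) (AddAction.mem_fixedBy.mp φ.2)
    simpa [vadd_val] using this⟩
  invFun ψ := ⟨⟨ψ.1, nonconst_of_antiperiodic ψ.2⟩, by
    rw [AddAction.mem_fixedBy]
    apply Subtype.ext
    funext y
    rw [vadd_val]
    exact ψ.2 y⟩
  left_inv φ := by
    apply Subtype.ext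
    apply Subtype.ext
    funext y
    rfl
  right_inv ψ := by
    apply Subtype.ext
    funext y
    rfl

/-- **The number of fixed points of `(1, y₀)`** on the nonconstant types: `2^{|A / ℤy₀|}` if the order of `y₀` is even, `0` if it is
odd. [folklore] -/
theorem card_fixedBy_one [Finite A] (y₀ : A) :
    Nat.card (AddAction.fixedBy (Nonconst A) (((1 : ZMod 2), y₀) : ZMod 2 × A)) =
      if Even (addOrderOf y₀) then 2 ^ Nat.card (A ⧸ AddSubgroup.zmultiples y₀) else 0 := by
  classical
  rw [Nat.card_congr (fixedByOneEquiv y₀)]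
  split_ifs with hev
  · obtain ⟨φ₁, h₁⟩ := exists_antiperiodic_of_even hev
    rw [Nat.card_congr ((antiperiodicEquiv φ₁ h₁).trans (periodicEquiv y₀)), Nat.card_fun, Nat.card_eq_fintype_card (α := ZMod 2),
      ZMod.card]
  · rw [Nat.card_eq_zero]
    left
    exact ⟨fun φ => hev (even_addOrderOf_of_antiperiodic φ.2)⟩

/-! ## §3 The orbit count (Burnside) for every finite abelian `A` -/

/-- A sum over `ℤ/2`. [folklore] -/
theorem sum_zmod_two (f : ZMod 2 → ℕ) : ∑ a : ZMod 2, f a = f 0 + f 1 := Fin.sum_univ_two f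

/-- **THE ORBIT COUNT (Burnside), any parity.**  The number of `G`-orbits of nonconstant types — isogeny classes of simple CM abelian
varieties other than `E` split by a Galois CM field with group `ℤ/2 × A` — satisfies
`#orbits · 2|A| = Σ_{y ∈ A} (2^{|A / ℤy|} − 2) + Σ_{y ∈ A, ord y even} 2^{|A / ℤy|}`. [folklore] -/
theorem card_orbitsA_mul_eq [Fintype A] [DecidableEq A] :
    Nat.card (OrbitsA A) * (2 * Fintype.card A) =
      (∑ y : A, (2 ^ Nat.card (A ⧸ AddSubgroup.zmultiples y) - 2)) +
        ∑ y ∈ univ.filter (fun y : A => Even (addOrderOf y)), 2 ^ Nat.card (A ⧸ AddSubgroup.zmultiples y) := by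
  classical
  have h01 : ∀ a : ZMod 2, a = 0 ∨ a = 1 := by decide
  have burnside :=
    AddAction.sum_card_fixedBy_eq_card_orbits_mul_card_addGroup (ZMod 2 × A) (Nonconst A)
  rw [Fintype.card_prod, ZMod.card] at burnside
  have hfix : ∀ g : ZMod 2 × A, Fintype.card (AddAction.fixedBy (Nonconst A) g) =
      if g.1 = 0 then 2 ^ Nat.card (A ⧸ AddSubgroup.zmultiples g.2) - 2 else
        (if Even (addOrderOf g.2) then 2 ^ Nat.card (A ⧸ AddSubgroup.zmultiples g.2) else 0) := by
    rintro ⟨a, y⟩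
    rcases h01 a with rfl | rfl
    · rw [if_pos rfl, ← Nat.card_eq_fintype_card]
      exact card_fixedBy_zero A y
    · rw [if_neg (by simp), ← Nat.card_eq_fintype_card]
      exact card_fixedBy_one A y
  simp_rw [hfix] at burnside
  rw [Fintype.sum_prod_type_right] at burnside
  simp_rw [sum_zmod_two] at burnside
  simp only [if_true, one_ne_zero, if_false] at burnside
  rw [Finset.sum_add_distrib, ← Finset.sum_filter] at burnside
  rw [Nat.card_eq_fintype_card]
  exact burnside.symm

/-! ## §4 Cyclic `A = ℤ/n`: the `gcd` form; instances `n = 4, 6, 8, 10, 12` -/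

/-- **The orbit count for `ℤ/2 × ℤ/n`, any `n`**: `#orbits · 2n = Σ_{a<n} ((2^{gcd(n,a)} − 2) + [n / gcd(n,a) even]·2^{gcd(n,a)})` (binary
necklaces of length `n` up to rotation and complementation, minus the constant one). [folklore] -/
theorem card_orbitsA_zmod_mul_eq (n : ℕ) [NeZero n] :
    Nat.card (OrbitsA (ZMod n)) * (2 * n) =
      ∑ a ∈ Finset.range n, ((2 ^ n.gcd a - 2) + if Even (n / n.gcd a) then 2 ^ n.gcd a else 0) := by
  have h := card_orbitsA_mul_eq (ZMod n)
  rw [ZMod.card, Finset.sum_filter, ← Finset.sum_add_distrib] at h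
  rw [h]
  have hterm : ∀ y : ZMod n, ((2 ^ Nat.card (ZMod n ⧸ AddSubgroup.zmultiples y) - 2) +
      if Even (addOrderOf y) then 2 ^ Nat.card (ZMod n ⧸ AddSubgroup.zmultiples y) else 0) =
      ((2 ^ n.gcd y.val - 2) + if Even (n / n.gcd y.val) then 2 ^ n.gcd y.val else 0) := by
    intro y
    have ho : addOrderOf y = n / n.gcd y.val := by
      conv_lhs => rw [← ZMod.natCast_zmod_val y]
      exact ZMod.addOrderOf_coe y.val (NeZero.ne n)
    rw [card_quotient_zmultiples_zmod, ho]
  simp_rw [hterm]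
  obtain ⟨k, rfl⟩ := Nat.exists_eq_succ_of_ne_zero (NeZero.ne n)
  exact Fin.sum_univ_eq_sum_range (fun a => (2 ^ (k + 1).gcd a - 2) + if Even ((k + 1) / (k + 1).gcd a) then 2 ^ (k + 1).gcd a else 0)
    (k + 1)

/-- `ℤ/2 × ℤ/4` (`c = (1,0)`; `ℚ(ζ₁₆)`, `ℚ(ζ₂₀)`, `ℚ(ζ₁₅)`): `3` isogeny classes of simple CM abelian varieties other than `E`. [folklore] -/
theorem card_orbitsA_zmod_four : Nat.card (OrbitsA (ZMod 4)) = 3 := by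
  have h := card_orbitsA_zmod_mul_eq 4
  have hs : ∑ a ∈ Finset.range 4, ((2 ^ Nat.gcd 4 a - 2) + if Even (4 / Nat.gcd 4 a) then 2 ^ Nat.gcd 4 a else 0) = 24 := by
    decide
  omega

/-- `ℤ/2 × ℤ/6` (`ℚ(ζ₂₁)`, `ℚ(ζ₂₈)`, `ℚ(ζ₃₆)`): `7` isogeny classes of simple CM abelian varieties other than `E`. [folklore] -/
theorem card_orbitsA_zmod_six : Nat.card (OrbitsA (ZMod 6)) = 7 := by
  have h := card_orbitsA_zmod_mul_eq 6
  have hs : ∑ a ∈ Finset.range 6, ((2 ^ Nat.gcd 6 a - 2) + if Even (6 / Nat.gcd 6 a) then 2 ^ Nat.gcd 6 a else 0) = 84 := by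
    decide
  omega

/-- `ℤ/2 × ℤ/8` (`ℚ(ζ₃₂)`): `19` isogeny classes of simple CM abelian varieties other than `E`. [folklore] -/
theorem card_orbitsA_zmod_eight : Nat.card (OrbitsA (ZMod 8)) = 19 := by
  have h := card_orbitsA_zmod_mul_eq 8
  have hs : ∑ a ∈ Finset.range 8, ((2 ^ Nat.gcd 8 a - 2) + if Even (8 / Nat.gcd 8 a) then 2 ^ Nat.gcd 8 a else 0) = 304 := by
    decide
  omega

/-- `ℤ/2 × ℤ/10` (`ℚ(ζ₃₃)`, `ℚ(ζ₄₄)`): `55` isogeny classes of simple CM abelian varieties other than `E`. [folklore] -/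
theorem card_orbitsA_zmod_ten : Nat.card (OrbitsA (ZMod 10)) = 55 := by
  have h := card_orbitsA_zmod_mul_eq 10
  have hs : ∑ a ∈ Finset.range 10, ((2 ^ Nat.gcd 10 a - 2) + if Even (10 / Nat.gcd 10 a) then 2 ^ Nat.gcd 10 a else 0) = 1100 := by
    decide
  omega

/-- `ℤ/2 × ℤ/12` (`ℚ(ζ₃₅)`, `ℚ(ζ₃₉)`, `ℚ(ζ₄₅)`, `ℚ(ζ₅₂)`): `179` isogeny classes of simple CM abelian varieties other than `E`
(lit-andre-3's `178 = 179 − 1` generating orbits). [folklore] -/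
theorem card_orbitsA_zmod_twelve : Nat.card (OrbitsA (ZMod 12)) = 179 := by
  have h := card_orbitsA_zmod_mul_eq 12
  have hs : ∑ a ∈ Finset.range 12, ((2 ^ Nat.gcd 12 a - 2) + if Even (12 / Nat.gcd 12 a) then 2 ^ Nat.gcd 12 a else 0) = 4296 := by
    decide
  omega

/-! ## §5 Elementary abelian `A = (ℤ/2)^r`: instances `(ℤ/2)²` and `(ℤ/2)³` -/

variable {A} in
/-- In a group killed by `2`, every non-zero element has order `2` and index `|A|/2`; `0` has order `1` and index `|A|`. [folklore] -/
theorem card_quotient_of_two_nsmul_eq_zero [Fintype A] [DecidableEq A] (h2 : ∀ y : A, 2 • y = 0) (y : A) :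
    Nat.card (A ⧸ AddSubgroup.zmultiples y) * (if y = 0 then 1 else 2) = Fintype.card A ∧
      addOrderOf y = (if y = 0 then 1 else 2) := by
  have ho : addOrderOf y = if y = 0 then 1 else 2 := by
    by_cases hy : y = 0
    · rw [if_pos hy, hy, addOrderOf_zero]
    · rw [if_neg hy]
      rcases (Nat.dvd_prime Nat.prime_two).mp (addOrderOf_dvd_of_nsmul_eq_zero (h2 y)) with h1 | h2'
      · exact absurd (AddMonoid.addOrderOf_eq_one_iff.mp h1) hy
      · exact h2'
  refine ⟨?_, ho⟩
  have hl := AddSubgroup.card_eq_card_quotient_mul_card_addSubgroup (AddSubgroup.zmultiples y)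
  rw [Nat.card_zmultiples, Nat.card_eq_fintype_card (α := A), ho] at hl
  exact hl.symm

/-- `(ℤ/2)³` (`c = (1,0,0)`; `ℚ(ζ₂₄)`, `ℚ(√−d, √a, √b)`): `4` isogeny classes of simple CM abelian varieties other than `E`. [folklore] -/
theorem card_orbitsA_zmod_two_sq : Nat.card (OrbitsA (ZMod 2 × ZMod 2)) = 4 := by
  have h := card_orbitsA_mul_eq (ZMod 2 × ZMod 2)
  have h2y : ∀ y : ZMod 2 × ZMod 2, 2 • y = 0 := by decide
  have hq : ∀ y : ZMod 2 × ZMod 2, Nat.card ((ZMod 2 × ZMod 2) ⧸ AddSubgroup.zmultiples y) = if y = 0 then 4 else 2 := by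
    intro y
    have := (card_quotient_of_two_nsmul_eq_zero h2y y).1
    rw [Fintype.card_prod, ZMod.card] at this
    split_ifs at this ⊢ <;> omega
  have ho : ∀ y : ZMod 2 × ZMod 2, Even (addOrderOf y) ↔ ¬ y = 0 := by
    intro y
    rw [(card_quotient_of_two_nsmul_eq_zero h2y y).2]
    split_ifs with hy
    · simp [hy]
    · simp [hy]
  simp_rw [hq] at h
  rw [Finset.filter_congr (fun y _ => ho y)] at h
  have hs1 : (∑ y : ZMod 2 × ZMod 2, (2 ^ (if y = 0 then 4 else 2) - 2)) = 20 := by decide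
  have hs2 : (∑ y ∈ univ.filter (fun y : ZMod 2 × ZMod 2 => ¬ y = 0), 2 ^ (if y = 0 then 4 else 2)) = 12 := by decide
  rw [hs1, hs2, Fintype.card_prod, ZMod.card] at h
  omega

/-- `(ℤ/2)⁴` (`c = (1,0,0,0)`; e.g. `ℚ(√−d, √a, √b, √e)`): `29` isogeny classes of simple CM abelian varieties other than `E` are split
by a Galois CM field with group `(ℤ/2)⁴`. [folklore] -/
theorem card_orbitsA_zmod_two_cube : Nat.card (OrbitsA (ZMod 2 × ZMod 2 × ZMod 2)) = 29 := by
  have h := card_orbitsA_mul_eq (ZMod 2 × ZMod 2 × ZMod 2)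
  have h2y : ∀ y : ZMod 2 × ZMod 2 × ZMod 2, 2 • y = 0 := by decide
  have hq : ∀ y : ZMod 2 × ZMod 2 × ZMod 2,
      Nat.card ((ZMod 2 × ZMod 2 × ZMod 2) ⧸ AddSubgroup.zmultiples y) = if y = 0 then 8 else 4 := by
    intro y
    have := (card_quotient_of_two_nsmul_eq_zero h2y y).1
    rw [Fintype.card_prod, Fintype.card_prod, ZMod.card] at this
    split_ifs at this ⊢ <;> omega
  have ho : ∀ y : ZMod 2 × ZMod 2 × ZMod 2, Even (addOrderOf y) ↔ ¬ y = 0 := by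
    intro y
    rw [(card_quotient_of_two_nsmul_eq_zero h2y y).2]
    split_ifs with hy
    · simp [hy]
    · simp [hy]
  simp_rw [hq] at h
  rw [Finset.filter_congr (fun y _ => ho y)] at h
  have hs1 : (∑ y : ZMod 2 × ZMod 2 × ZMod 2, (2 ^ (if y = 0 then 8 else 4) - 2)) = 352 := by decide
  have hs2 : (∑ y ∈ univ.filter (fun y : ZMod 2 × ZMod 2 × ZMod 2 => ¬ y = 0), 2 ^ (if y = 0 then 8 else 4)) = 112 := by
    decide
  rw [hs1, hs2, Fintype.card_prod, Fintype.card_prod, ZMod.card] at h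
  omega

end Summit.HodgeConjecture.CorCM.Census.EvenSliceOrbitCount
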